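import Literature.MathematicalPhysics.KineticTheory.DuhamelSliceTime
import Literature.MathematicalPhysics.KineticTheory.TruncatedPicardEstimates
import Literature.MathematicalPhysics.KineticTheory.TruncatedPicardLipschitz
import HarnessLib

/-!
# The Picard iteration for the truncated Boltzmann equation: the class of the iterates

Topic: MathematicalPhysics / KineticTheory. The iteration of CIP 1994 §5.3 Lemma 5.3.6 (p. 146,
`Tf^{n+1} = Q̃(fⁿ, fⁿ)`, here in the positivity-preserving form with the loss term implicit):
`F₀(t) = f₀ ∘ A_t` and
`F_{m+1}(t, z) = f₀(A_t z) e^{-∫₀ᵗ Λ_m(σ)(A_{t-σ}z) dσ} + ∫₀ᵗ e^{-∫ₛᵗ Λ_m(σ)(A_{t-σ}z) dσ} Γ_m(s)(A_{t-s} z) ds`,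
`Λ_m(s) = absorption δ B (F_m(s))`, `Γ_m(s) = source δ B (F_m(s))` (`TruncatedPicardFunctionals`),
times being clamped to `[0, ∞)`. The sequence `F` enters through the recursion hypotheses (no
definition is made here). This file shows that every iterate stays in the class
`TruncPicard.SliceClass` of time-dependent families of *nonnegative Schwartz-type slices*,
smooth in `(x, v)` for every `t`, with all weighted derivatives bounded on compact time
intervals, continuous in time, constant for `t ≤ 0` (`SliceClass.iterate`), and records the
admissibility of the families `Λ_m, Γ_m` that the Duhamel theory (`DuhamelSlice*`) consumes
(`SliceClass.absorptionFamily`, `SliceClass.sourceFamily`), together with the positivity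
`F_{m+1}(t, z) ≥ f₀(A_t z) e^{-C t}`.

## References

* C. Cercignani, R. Illner, M. Pulvirenti, *The Mathematical Theory of Dilute Gases*, Springer
  (1994), §5.3 Lemma 5.3.6, pp. 145–146.
-/

open MeasureTheory Metric Real Set Filter Function intervalIntegral
open scoped InnerProductSpace ENNReal ContDiff Topology

noncomputable section

namespace Literature.MathematicalPhysics.KineticTheory

open Literature.Analysis.Calculus Literature.Analysis.FluidPDE

variable {E : Type*} [NormedAddCommGroup E] [InnerProductSpace ℝ E] [FiniteDimensional ℝ E]
  [MeasurableSpace E] [BorelSpace E]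

namespace TruncPicard

/-- *The class of the Picard iterates*: time-dependent families of nonnegative smooth slices with
all polynomially weighted derivatives bounded on compact time intervals, continuous in time
pointwise, and constant for `t ≤ 0` (times are clamped to `[0, ∞)`). [folklore] -/
structure SliceClass (H : ℝ → E × E → ℝ) : Prop where
  /-- every slice is smooth -/
  contDiff : ∀ t, ContDiff ℝ ∞ (H t)
  /-- every slice is nonnegative -/
  nonneg : ∀ t z, 0 ≤ H t z
  /-- weighted derivatives of all orders are bounded on compact time intervals -/
  bounds : ∀ T : ℝ, 0 ≤ T → ∀ n k : ℕ, ∃ C : ℝ, ∀ t ∈ Icc (0:ℝ) T, ∀ z : E × E,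
    (1 + ‖z‖) ^ k * ‖iteratedFDeriv ℝ n (H t) z‖ ≤ C
  /-- continuity in time, pointwise -/
  continuousOn : ∀ T : ℝ, 0 ≤ T → ∀ z, ContinuousOn (fun t => H t z) (Icc 0 T)
  /-- negative times are clamped to `0` -/
  clamp : ∀ t ≤ 0, H t = H 0

variable {δ : ℝ} {B : E × E → sphere (0 : E) 1 → ℝ} {M R : ℝ} {H : ℝ → E × E → ℝ}

omit [FiniteDimensional ℝ E] [MeasurableSpace E] [BorelSpace E] in
/-- Each slice of a family in the class has a full family of weighted bounds. [folklore] -/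
theorem SliceClass.slice_bounds (hH : SliceClass H) (t : ℝ) :
    ∃ C : ℕ → ℕ → ℝ, ∀ (n k : ℕ) (z : E × E), (1 + ‖z‖) ^ k * ‖iteratedFDeriv ℝ n (H t) z‖ ≤ C n k := by
  rcases le_or_gt t 0 with ht | ht
  · rw [hH.clamp t ht]
    choose C hC using hH.bounds 0 le_rfl
    exact ⟨C, fun n k z => hC n k 0 ⟨le_rfl, le_rfl⟩ z⟩
  · choose C hC using hH.bounds t ht.le
    exact ⟨C, fun n k z => hC n k t ⟨ht.le, le_rfl⟩ z⟩

omit [FiniteDimensional ℝ E] [MeasurableSpace E] [BorelSpace E] in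
/-- Uniform bounds as functions of the order and the weight. [folklore] -/
theorem SliceClass.uniform_bounds (hH : SliceClass H) {T : ℝ} (hT : 0 ≤ T) :
    ∃ C : ℕ → ℕ → ℝ, ∀ (n k : ℕ), ∀ t ∈ Icc (0:ℝ) T, ∀ z : E × E,
      (1 + ‖z‖) ^ k * ‖iteratedFDeriv ℝ n (H t) z‖ ≤ C n k := by
  choose C hC using hH.bounds T hT
  exact ⟨C, hC⟩

/-- **The absorption family of a family in the class is admissible** for the Duhamel theory:
smooth slices, continuous in time on `[0, T]`, derivatives of all orders bounded on `[0, T]`,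
nonnegative, and bounded by `‖B‖₁ sup H`. [folklore] -/
theorem SliceClass.absorptionFamily (hH : SliceClass H) (h : KernelHyp B M R) (hδ : 0 ≤ δ) {T : ℝ}
    (hT : 0 ≤ T) :
    (∀ σ, ContDiff ℝ ∞ (absorption δ B (H σ))) ∧
    (∀ y, ContinuousOn (fun σ => absorption δ B (H σ) y) (Icc 0 T)) ∧
    (∀ n : ℕ, ∃ C : ℝ, ∀ σ ∈ Icc (0:ℝ) T, ∀ y, ‖iteratedFDeriv ℝ n (absorption δ B (H σ)) y‖ ≤ C) ∧
    (∀ σ ∈ Icc (0:ℝ) T, ∀ y, 0 ≤ absorption δ B (H σ) y) ∧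
    (∃ C₀ : ℝ, ∀ σ ∈ Icc (0:ℝ) T, ∀ y, absorption δ B (H σ) y ≤ C₀) := by
  obtain ⟨CU, hCU⟩ := hH.uniform_bounds hT
  have h1 : ∀ σ, ContDiff ℝ ∞ (absorption δ B (H σ)) := fun σ => by
    obtain ⟨C, hC⟩ := hH.slice_bounds σ
    exact contDiff_absorption h hδ (hH.contDiff σ) (hH.nonneg σ) hC
  -- sup bounds on `[0, T]`
  have h00 : ∀ σ ∈ Icc (0:ℝ) T, ∀ y, |H σ y| ≤ CU 0 0 := fun σ hσ y => by
    have := hCU 0 0 σ hσ y; rwa [pow_zero, one_mul, norm_iteratedFDeriv_zero, Real.norm_eq_abs] at this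
  have h0d : ∀ σ ∈ Icc (0:ℝ) T, ∀ y : E × E,
      (1 + ‖y‖) ^ (Module.finrank ℝ E + 1) * |H σ y| ≤ CU 0 (Module.finrank ℝ E + 1) := fun σ hσ y => by
    have := hCU 0 (Module.finrank ℝ E + 1) σ hσ y; rwa [norm_iteratedFDeriv_zero, Real.norm_eq_abs] at this
  set Mb : ℝ := max (CU 0 0) (CU 0 (Module.finrank ℝ E + 1))
  have h2 : ∀ y, ContinuousOn (fun σ => absorption δ B (H σ) y) (Icc 0 T) := fun y σ₀ hσ₀ =>
    (continuousWithinAt_functionals h hδ hσ₀ (fun s _ => (hH.contDiff s).continuous)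
      (fun s _ => hH.nonneg s) (Mb := Mb) (fun s hs y => (h00 s hs y).trans (le_max_left _ _))
      (fun s hs y => (h0d s hs y).trans (le_max_right _ _)) (fun y => hH.continuousOn T hT y σ₀ hσ₀) y).2.2.2.1
  have h4 : ∀ σ ∈ Icc (0:ℝ) T, ∀ y, 0 ≤ absorption δ B (H σ) y := fun σ _ y =>
    (absorption_nonneg_le h hδ (hH.contDiff σ).continuous (hH.nonneg σ) (abs_le_of_bounds
      (Classical.choose_spec (hH.slice_bounds σ))) y).1
  have h5 : ∀ σ ∈ Icc (0:ℝ) T, ∀ y, absorption δ B (H σ) y ≤ kernelMass B * CU 0 0 := fun σ hσ y =>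
    (absorption_nonneg_le h hδ (hH.contDiff σ).continuous (hH.nonneg σ) (h00 σ hσ) y).2
  refine ⟨h1, h2, fun n => ?_, h4, ⟨_, h5⟩⟩
  rcases Nat.eq_zero_or_pos n with hn | hn
  · subst hn
    refine ⟨kernelMass B * CU 0 0, fun σ hσ y => ?_⟩
    rw [norm_iteratedFDeriv_zero, Real.norm_of_nonneg (h4 σ hσ y)]
    exact h5 σ hσ y
  · set k : ℕ := Module.finrank ℝ E + 1
    set L : ℝ := ∑ i ∈ Finset.range n, |CU i k|
    have hL0 : 0 ≤ L := Finset.sum_nonneg fun i _ => abs_nonneg _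
    have hLi : ∀ σ ∈ Icc (0:ℝ) T, ∀ i < n, ∀ y : E × E, (1 + ‖y‖) ^ k * ‖iteratedFDeriv ℝ i (H σ) y‖ ≤ L :=
      fun σ hσ i hi y => ((hCU i k σ hσ y).trans (le_abs_self _)).trans
        (Finset.single_le_sum (f := fun i => |CU i k|) (fun i _ => abs_nonneg _) (Finset.mem_range.2 hi))
    obtain ⟨c₁, c₂, -, -, hc⟩ := absorption_level_bound (B := B) h hδ hn (le_refl k) hL0
    refine ⟨c₁ * CU n k + c₂, fun σ hσ y => ?_⟩
    obtain ⟨C, hC⟩ := hH.slice_bounds σ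
    exact hc (H σ) C (CU n k) (hH.contDiff σ) (hH.nonneg σ) hC (hLi σ hσ) (fun y => hCU n k σ hσ y) y

/-- **The source family of a family in the class is admissible** for the Duhamel theory: smooth
slices, continuous in time on `[0, T]`, weighted derivatives of all orders bounded on `[0, T]`,
nonnegative. [folklore] -/
theorem SliceClass.sourceFamily (hH : SliceClass H) (h : KernelHyp B M R) (hδ : 0 ≤ δ) {T : ℝ} (hT : 0 ≤ T) :
    (∀ s, ContDiff ℝ ∞ (source δ B (H s))) ∧
    (∀ y, ContinuousOn (fun s => source δ B (H s) y) (Icc 0 T)) ∧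
    (∀ n k : ℕ, ∃ C : ℝ, ∀ s ∈ Icc (0:ℝ) T, ∀ y : E × E,
      (1 + ‖y‖) ^ k * ‖iteratedFDeriv ℝ n (source δ B (H s)) y‖ ≤ C) ∧
    (∀ s ∈ Icc (0:ℝ) T, ∀ y, 0 ≤ source δ B (H s) y) := by
  obtain ⟨CU, hCU⟩ := hH.uniform_bounds hT
  have h1 : ∀ s, ContDiff ℝ ∞ (source δ B (H s)) := fun s => by
    obtain ⟨C, hC⟩ := hH.slice_bounds s
    exact contDiff_source h hδ (hH.contDiff s) (hH.nonneg s) hC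
  have h00 : ∀ σ ∈ Icc (0:ℝ) T, ∀ y, |H σ y| ≤ CU 0 0 := fun σ hσ y => by
    have := hCU 0 0 σ hσ y; rwa [pow_zero, one_mul, norm_iteratedFDeriv_zero, Real.norm_eq_abs] at this
  have h0k : ∀ k, ∀ σ ∈ Icc (0:ℝ) T, ∀ y : E × E, (1 + ‖y‖) ^ k * |H σ y| ≤ CU 0 k := fun k σ hσ y => by
    have := hCU 0 k σ hσ y; rwa [norm_iteratedFDeriv_zero, Real.norm_eq_abs] at this
  set Mb : ℝ := max (CU 0 0) (CU 0 (Module.finrank ℝ E + 1))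
  have h2 : ∀ y, ContinuousOn (fun s => source δ B (H s) y) (Icc 0 T) := fun y σ₀ hσ₀ =>
    (continuousWithinAt_functionals h hδ hσ₀ (fun s _ => (hH.contDiff s).continuous)
      (fun s _ => hH.nonneg s) (Mb := Mb) (fun s hs y => (h00 s hs y).trans (le_max_left _ _))
      (fun s hs y => (h0k _ s hs y).trans (le_max_right _ _)) (fun y => hH.continuousOn T hT y σ₀ hσ₀) y).2.2.2.2
  have h4 : ∀ s ∈ Icc (0:ℝ) T, ∀ y, 0 ≤ source δ B (H s) y := fun s _ y => source_nonneg h hδ (hH.nonneg s) y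
  refine ⟨h1, h2, fun n k => ?_, h4⟩
  -- reduce to weights `k' ≥ d + 1`
  set k' : ℕ := max k (Module.finrank ℝ E + 1)
  have hk' : Module.finrank ℝ E + 1 ≤ k' := le_max_right _ _
  suffices H' : ∃ C : ℝ, ∀ s ∈ Icc (0:ℝ) T, ∀ y : E × E,
      (1 + ‖y‖) ^ k' * ‖iteratedFDeriv ℝ n (source δ B (H s)) y‖ ≤ C by
    obtain ⟨C, hC⟩ := H'
    exact ⟨C, fun s hs y => weight_mono (g := source δ B (H s)) (le_max_left _ _) (hC s hs) y⟩
  rcases Nat.eq_zero_or_pos n with hn | hn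
  · subst hn
    refine ⟨kernelMass B * (2 ^ (k' + 1) * CU 0 k' * CU 0 0), fun s hs y => ?_⟩
    rw [norm_iteratedFDeriv_zero, Real.norm_of_nonneg (h4 s hs y)]
    exact weight_mul_source_le h hδ (hH.nonneg s) (h0k k' s hs) (h00 s hs) y
  · set L : ℝ := ∑ i ∈ Finset.range n, |CU i k'|
    have hL0 : 0 ≤ L := Finset.sum_nonneg fun i _ => abs_nonneg _
    have hLi : ∀ σ ∈ Icc (0:ℝ) T, ∀ i < n, ∀ y : E × E, (1 + ‖y‖) ^ k' * ‖iteratedFDeriv ℝ i (H σ) y‖ ≤ L :=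
      fun σ hσ i hi y => ((hCU i k' σ hσ y).trans (le_abs_self _)).trans
        (Finset.single_le_sum (f := fun i => |CU i k'|) (fun i _ => abs_nonneg _) (Finset.mem_range.2 hi))
    obtain ⟨c₁, c₂, -, -, hc⟩ := source_level_bound (B := B) h hδ hn hk' hL0
    refine ⟨c₁ * CU n k' + c₂, fun s hs y => ?_⟩
    obtain ⟨C, hC⟩ := hH.slice_bounds s
    exact hc (H s) C (CU n k') (hH.contDiff s) (hH.nonneg s) hC (hLi s hs) (fun y => hCU n k' s hs y) y

/-! ## The iterates stay in the class -/

variable {f₀ : E × E → ℝ}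

omit [FiniteDimensional ℝ E] [MeasurableSpace E] [BorelSpace E] in
/-- **The free-transport iterate `F₀(t) = f₀ ∘ A_{t₊}` is in the class.** [folklore] -/
theorem SliceClass.initial (hf₀ : ContDiff ℝ ∞ f₀) (hf₀0 : ∀ y, 0 ≤ f₀ y)
    (hf₀b : ∀ n k : ℕ, ∃ C : ℝ, ∀ y : E × E, (1 + ‖y‖) ^ k * ‖iteratedFDeriv ℝ n f₀ y‖ ≤ C)
    {H : ℝ → E × E → ℝ} (hH : ∀ t z, H t z = f₀ (z.1 - max t 0 • z.2, z.2)) : SliceClass H := by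
  have hfun : ∀ t, H t = fun z : E × E => f₀ (z.1 - max t 0 • z.2, z.2) := fun t => funext (hH t)
  refine ⟨fun t => ?_, fun t z => ?_, fun T hT n k => ?_, fun T hT z => ?_, fun t ht => ?_⟩
  · rw [hfun t]; exact contDiff_comp_shear hf₀ _
  · rw [hH t z]; exact hf₀0 _
  · obtain ⟨C, hC⟩ := hf₀b n k
    refine ⟨(1 + T) ^ (k + n) * C, fun t ht z => ?_⟩
    rw [hfun t]
    exact weight_mul_norm_iteratedFDeriv_comp_shear_le hf₀ (by rw [max_eq_left ht.1, abs_of_nonneg ht.1]; exact ht.2) hC z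
  · have : Continuous fun t : ℝ => f₀ (z.1 - max t 0 • z.2, z.2) :=
      hf₀.continuous.comp ((continuous_const.sub ((continuous_id.max continuous_const).smul
        continuous_const)).prodMk continuous_const)
    exact (this.continuousOn).congr fun t _ => hH t z
  · funext z; rw [hH t z, hH 0 z, max_eq_right ht, max_self]

/-- **The Picard map preserves the class, and its values are bounded below by free transport.**
If `H` is in the class and `U` is given, at every clamped time `t₊ = max t 0`, by the Duhamel
formula with absorption `Λ(s) = absorption δ B (H s)` and source `Γ(s) = source δ B (H s)`, then
`U` is in the class and `U(t, z) ≥ f₀(A_t z) e^{-C t}` on `[0, T]` with `C = ‖B‖₁ sup_{[0,T]} H`.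
[cite: CIPDiluteGases1994, §5.3 Lemma 5.3.6 (p. 146)] -/
theorem SliceClass.next (hH : SliceClass H) (h : KernelHyp B M R) (hδ : 0 ≤ δ) (hf₀ : ContDiff ℝ ∞ f₀)
    (hf₀0 : ∀ y, 0 ≤ f₀ y)
    (hf₀b : ∀ n k : ℕ, ∃ C : ℝ, ∀ y : E × E, (1 + ‖y‖) ^ k * ‖iteratedFDeriv ℝ n f₀ y‖ ≤ C)
    {U : ℝ → E × E → ℝ}
    (hU : ∀ t z, U t z =
      f₀ (z.1 - max t 0 • z.2, z.2) * Real.exp (-(∫ σ in (0:ℝ)..max t 0,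
        absorption δ B (H σ) (z.1 - (max t 0 - σ) • z.2, z.2))) +
        ∫ s in (0:ℝ)..max t 0, Real.exp (-(∫ σ in s..max t 0,
          absorption δ B (H σ) (z.1 - (max t 0 - σ) • z.2, z.2))) *
          source δ B (H s) (z.1 - (max t 0 - s) • z.2, z.2)) :
    SliceClass U ∧ ∀ T : ℝ, 0 ≤ T → ∃ C₀ : ℝ, ∀ t ∈ Icc (0:ℝ) T, ∀ z : E × E,
      f₀ (z.1 - t • z.2, z.2) * Real.exp (-(C₀ * t)) ≤ U t z := by
  -- the Duhamel formula on `[0, T]`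
  have hUT : ∀ T : ℝ, ∀ t ∈ Icc (0:ℝ) T, ∀ z : E × E, U t z =
      f₀ (z.1 - t • z.2, z.2) * Real.exp (-(∫ σ in (0:ℝ)..t,
        absorption δ B (H σ) (z.1 - (t - σ) • z.2, z.2))) +
        ∫ s in (0:ℝ)..t, Real.exp (-(∫ σ in s..t, absorption δ B (H σ) (z.1 - (t - σ) • z.2, z.2))) *
          source δ B (H s) (z.1 - (t - s) • z.2, z.2) := fun T t ht z => by
    rw [hU t z, max_eq_left ht.1]
  have hclamp : ∀ t ≤ 0, U t = U 0 := fun t ht => by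
    funext z; rw [hU t z, hU 0 z, max_eq_right ht, max_self]
  have hU0 : ∀ z, U 0 z = f₀ z := fun z => by
    rw [hU 0 z, max_self]; simp
  -- the consequences of the Duhamel theory on each `[0, T]`
  have key : ∀ T : ℝ, 0 ≤ T →
      (∀ t ∈ Icc (0:ℝ) T, ContDiff ℝ ∞ (U t)) ∧
      (∀ n k : ℕ, ∃ C : ℝ, ∀ t ∈ Icc (0:ℝ) T, ∀ z : E × E, (1 + ‖z‖) ^ k * ‖iteratedFDeriv ℝ n (U t) z‖ ≤ C) ∧
      (∀ z, ContinuousOn (fun t => U t z) (Icc 0 T)) ∧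
      (∃ C₀ : ℝ, ∀ t ∈ Icc (0:ℝ) T, ∀ z : E × E, f₀ (z.1 - t • z.2, z.2) * Real.exp (-(C₀ * t)) ≤ U t z) := by
    intro T hT
    obtain ⟨hL1, hL2, hL3, hL4, C₀, hLC⟩ := hH.absorptionFamily h hδ hT
    obtain ⟨hG1, hG2, hG3, hG4⟩ := hH.sourceFamily h hδ hT
    have hc : ∀ t ∈ Icc (0:ℝ) T, ContDiff ℝ ∞ (U t) := fun t ht =>
      duhamel_slice_contDiff hf₀ hL1 hL2 hL3 hL4 hG1 hG2 hG3 (hUT T) ht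
    have hb : ∀ n k : ℕ, ∃ C : ℝ, ∀ t ∈ Icc (0:ℝ) T, ∀ z : E × E, (1 + ‖z‖) ^ k * ‖iteratedFDeriv ℝ n (U t) z‖ ≤ C :=
      fun n k => duhamel_slice_bounds hf₀ hf₀b hL1 hL2 hL3 hL4 hG1 hG2 hG3 (hUT T) hT n k
    refine ⟨hc, hb, fun z => ?_, ⟨C₀, fun t ht z => duhamel_lower_bound' hL1 hL2 hL3 hLC hG4 hf₀0 (hUT T) ht z⟩⟩
    obtain ⟨M₁, hM₁⟩ := hb 1 0
    exact duhamel_continuousOn_time hf₀ hL1 hL2 hL3 hL4 hG1 hG2 hG3 (hUT T)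
      (fun t ht y => by simpa using hM₁ t ht y) z
  refine ⟨⟨fun t => ?_, fun t z => ?_, fun T hT n k => (key T hT).2.1 n k, fun T hT z => (key T hT).2.2.1 z, hclamp⟩,
    fun T hT => (key T hT).2.2.2⟩
  · rcases le_or_gt t 0 with ht | ht
    · rw [hclamp t ht]; exact (key 0 le_rfl).1 0 ⟨le_rfl, le_rfl⟩
    · exact (key t ht.le).1 t ⟨ht.le, le_rfl⟩
  · rcases le_or_gt t 0 with ht | ht
    · rw [hclamp t ht, hU0]; exact hf₀0 z
    · obtain ⟨C₀, hC₀⟩ := (key t ht.le).2.2.2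
      exact le_trans (mul_nonneg (hf₀0 _) (Real.exp_pos _).le) (hC₀ t ⟨ht.le, le_rfl⟩ z)

/-! ## The Picard sequence -/

/-- *The Picard sequence of the truncated problem* (CIP 1994 p. 146, positivity-preserving form,
times clamped to `[0, ∞)`): `F₀(t) = f₀ ∘ A_{t₊}` and `F_{m+1}` is the Duhamel formula with
absorption `absorption δ B (F_m(s))` and source `source δ B (F_m(s))` at the clamped time `t₊`.
[cite: CIPDiluteGases1994, §5.3 Lemma 5.3.6 (p. 146)] -/
structure IsPicardSequence (δ : ℝ) (B : E × E → sphere (0 : E) 1 → ℝ) (f₀ : E × E → ℝ)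
    (F : ℕ → ℝ → E × E → ℝ) : Prop where
  /-- the free-transport start -/
  initial : ∀ t z, F 0 t z = f₀ (z.1 - max t 0 • z.2, z.2)
  /-- the Duhamel step -/
  step : ∀ m t z, F (m + 1) t z =
    f₀ (z.1 - max t 0 • z.2, z.2) * Real.exp (-(∫ σ in (0:ℝ)..max t 0,
      absorption δ B (F m σ) (z.1 - (max t 0 - σ) • z.2, z.2))) +
      ∫ s in (0:ℝ)..max t 0, Real.exp (-(∫ σ in s..max t 0,
        absorption δ B (F m σ) (z.1 - (max t 0 - σ) • z.2, z.2))) *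
        source δ B (F m s) (z.1 - (max t 0 - s) • z.2, z.2)

variable {F : ℕ → ℝ → E × E → ℝ}

/-- **Every Picard iterate is in the class.** [cite: CIPDiluteGases1994, §5.3 Lemma 5.3.6 (p. 146)] -/
theorem IsPicardSequence.sliceClass (hP : IsPicardSequence δ B f₀ F) (h : KernelHyp B M R) (hδ : 0 ≤ δ)
    (hf₀ : ContDiff ℝ ∞ f₀) (hf₀0 : ∀ y, 0 ≤ f₀ y)
    (hf₀b : ∀ n k : ℕ, ∃ C : ℝ, ∀ y : E × E, (1 + ‖y‖) ^ k * ‖iteratedFDeriv ℝ n f₀ y‖ ≤ C) (m : ℕ) :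
    SliceClass (F m) := by
  induction m with
  | zero => exact SliceClass.initial hf₀ hf₀0 hf₀b hP.initial
  | succ m ih => exact (ih.next h hδ hf₀ hf₀0 hf₀b (hP.step m)).1

/-- The Duhamel formula of the Picard step on `[0, T]` (unclamped). [folklore] -/
theorem IsPicardSequence.step_Icc (hP : IsPicardSequence δ B f₀ F) (m : ℕ) (T : ℝ) :
    ∀ t ∈ Icc (0:ℝ) T, ∀ z : E × E, F (m + 1) t z =
      f₀ (z.1 - t • z.2, z.2) * Real.exp (-(∫ σ in (0:ℝ)..t,
        absorption δ B (F m σ) (z.1 - (t - σ) • z.2, z.2))) +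
        ∫ s in (0:ℝ)..t, Real.exp (-(∫ σ in s..t, absorption δ B (F m σ) (z.1 - (t - σ) • z.2, z.2))) *
          source δ B (F m s) (z.1 - (t - s) • z.2, z.2) := fun t ht z => by
  rw [hP.step m t z, max_eq_left ht.1]

/-- **Positivity along the iteration**: `F_{m+1}(t, z) ≥ f₀(A_t z) e^{-C t}` on `[0, T]`.
[cite: CIPDiluteGases1994, §5.3 Lemma 5.3.6 (p. 146)] -/
theorem IsPicardSequence.lower_bound (hP : IsPicardSequence δ B f₀ F) (h : KernelHyp B M R) (hδ : 0 ≤ δ)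
    (hf₀ : ContDiff ℝ ∞ f₀) (hf₀0 : ∀ y, 0 ≤ f₀ y)
    (hf₀b : ∀ n k : ℕ, ∃ C : ℝ, ∀ y : E × E, (1 + ‖y‖) ^ k * ‖iteratedFDeriv ℝ n f₀ y‖ ≤ C) (m : ℕ)
    {T : ℝ} (hT : 0 ≤ T) :
    ∃ C₀ : ℝ, ∀ t ∈ Icc (0:ℝ) T, ∀ z : E × E, f₀ (z.1 - t • z.2, z.2) * Real.exp (-(C₀ * t)) ≤ F (m + 1) t z :=
  ((hP.sliceClass h hδ hf₀ hf₀0 hf₀b m).next h hδ hf₀ hf₀0 hf₀b (hP.step m)).2 T hT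

end TruncPicard

end Literature.MathematicalPhysics.KineticTheory
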